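import Mathlib
import Literature.Analysis.FluidPDE.SuitableWeak
import Summits.NavierStokesRegularity.NavierStokesRegularity.Theorems.LandauTailLandauTailBlowupScaledDissipation

/-!
# The CKN scaled dissipation `E(r)` diverges at a Landau-tailed blow-up

Helper file for crux `LandauTailBlowup` (stmt-NavierStokesRegularity-1944), line `registered`,
registered stub `landauTail_cknE_tendsto_top` (E0b, "the scaled dissipation `E(r)` of CKN diverges,
in the tree's `Fluid.cknE` vocabulary with the classical gradient") of lead cycle c6.

Let `(u, p)` be a classical unit-viscosity solution of the unforced Navier–Stokes system on
`ℝ³ × (−1, 0)` with the parabolic tail `√(−t) u(t, √(−t) y) → U y` (`y ≠ 0`) to a nonzero steady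
`(−1)`-homogeneous profile `(U, P)` smooth off the origin (a witness of the body of `LandauTailLocal`).

Claim (E0b).  The Caffarelli–Kohn–Nirenberg scaled dissipation of the backward parabolic cylinders
`Q_r(0,0) = (−r², 0) × B_r` centred at the singular point, taken with the classical gradient
`∇u = fderiv ℝ (u t) x`, diverges: `cknE r (0,0) (∇u) = r⁻¹ ∫∫_{Q_r(0,0)} |∇u|² → ∞` as `r → 0⁺`.

Proof.  This is a vocabulary bridge to `landauTail_scaledDissipation_tendsto_top` (B4, p168595), which
proves `ofReal r⁻¹ * ∫∫_{Q_r(0,0)} ofReal |∇u|² → ∞`; the definition `cknE` carries the prefactor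
`(ofReal r)⁻¹` instead, and the two agree for `r > 0` (`ENNReal.ofReal_inv_of_pos`), hence eventually
along `𝓝[>] 0` (`Filter.Tendsto.congr'`).

References: L. Caffarelli, R. Kohn, L. Nirenberg, CPAM 35 (1982), §2 (2.5) (`δ(r)`); G. Seregin,
*Lecture Notes on Regularity Theory for the Navier–Stokes Equations* (2014), ch. 6 (scaled energy
quantities).
-/

set_option linter.dupNamespace false

namespace Summit.NavierStokesRegularity.NavierStokesRegularity.Theorems

open MeasureTheory Set Filter Topology Metric
open scoped ENNReal NNReal
open Literature.Analysis.FluidPDE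

/-- **E0b — the scaled dissipation `E(r)` of CKN diverges at a Landau-tailed singular point**
(vocabulary bridge to `Fluid.cknE` with the classical gradient): for every Landau-tailed local classical
solution, `cknE r (0,0) (∇u) = r⁻¹ ∫∫_{Q_r(0,0)} |∇u|² → ∞` as `r → 0⁺`
(`landauTail_scaledDissipation_tendsto_top`, rewritten along `r > 0` with `(ofReal r)⁻¹ = ofReal r⁻¹`).
(CKN 1982, §2 (2.5); Seregin 2014, ch. 6.) -/
theorem landauTail_cknE_tendsto_top : ∀ (u : ℝ → EuclideanSpace ℝ (Fin 3) → EuclideanSpace ℝ (Fin 3)) (p : ℝ → EuclideanSpace ℝ (Fin 3) → ℝ) (U : EuclideanSpace ℝ (Fin 3) → EuclideanSpace ℝ (Fin 3)) (P : EuclideanSpace ℝ (Fin 3) → ℝ), (ContDiffOn ℝ (⊤ : ℕ∞) U {0}ᶜ ∧ ContDiffOn ℝ (⊤ : ℕ∞) P {0}ᶜ ∧ (∀ x : EuclideanSpace ℝ (Fin 3), x ≠ 0 → Literature.Analysis.FluidPDE.convect U U x + gradient P x = (1 : ℝ) • Laplacian.laplacian U x) ∧ (∀ x : EuclideanSpace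 ℝ (Fin 3), x ≠ 0 → Literature.Analysis.FluidPDE.VectorCalculus.divergence U x = 0) ∧ (∀ c : ℝ, 0 < c → ∀ x : EuclideanSpace ℝ (Fin 3), U (c • x) = c⁻¹ • U x) ∧ (∃ x : EuclideanSpace ℝ (Fin 3), U x ≠ 0)) → Literature.Analysis.FluidPDE.IsClassicalNSSolutionOn (Set.Ioo (-1) 0) 1 0 u p → (∀ y : EuclideanSpace ℝ (Fin 3), y ≠ 0 → Filter.Tendsto (fun t : ℝ => Real.sqrt (0 - t) • u t (Real.sqrt (0 - t) • y)) (nhdsWithin 0 (Set.Iio 0)) (nhds (U y))) → Filter.Tendsto (fun r : ℝ => Literature.Analysis.FluidPDE.cknE r ((0 : ℝ), (0 : EuclideanSpace ℝ (Fin 3))) (fun t x => fderiv ℝ (u t) x)) (nhdsWithin 0 (Set.Ioi 0)) (nhds ⊤) := by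
  intro u p U P hprof hcl htail
  have hE := landauTail_scaledDissipation_tendsto_top u p U P hprof hcl htail
  refine hE.congr' ?_
  filter_upwards [self_mem_nhdsWithin] with r hr
  rw [mem_Ioi] at hr
  unfold cknE
  rw [ENNReal.ofReal_inv_of_pos hr]

end Summit.NavierStokesRegularity.NavierStokesRegularity.Theorems
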